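import Summits.AtomisticToContinuum.HydrodynamicLimit.Theorems.OneSphereInfluenceMeanVarianceL2ScoreCore
import HarnessLib

/-!
# Glue `MeanVarianceL2` of route `OneSphereInfluence`, part 2b: the finite-`N` score identity

Support file (`--supports stmt-AtomisticToContinuum-13622`) for the support item `MeanVarianceL2`
(`Summit.AtomisticToContinuum.HydrodynamicLimit.Theses.OneSphereInfluence.MeanVarianceL2`).

**The score identity.** Along a smooth positive one-parameter family of local Gibbs profiles
`(a_s, u_s, θ_s)`, `s ∈ [0,1]`, and for an `s`-INDEPENDENT observable `G` of at most quadratic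
velocity growth, `|G(z)| ≤ K (1 + ∑ₖ |vₖ|²)`, the Gibbs mean `s ↦ E_{p_s} G` is differentiable
within `[0,1]` with derivative the covariance of `G` with the SCORE
`S_s(z) = ∑ₖ ∂ₛ log prof_s(zₖ)`:  `d/ds E_{p_s} G = Cov_{p_s}(S_s, G)`, and the covariance is
continuous in `s` (`hasDerivWithinAt_integral_localGibbsLaw`). Likelihood-ratio / score-function
calculus (e.g. the finite-dimensional case behind Last–Penrose, *Lectures on the Poisson Process*,
Thm 19.1); here: differentiation under the integral sign of `A(s) = ∫ 𝟙_D ∏ₖ prof_s(zₖ) G dz` and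
of the partition function `Z(s)`, with the Gaussian domination of the MacroClosure ledger calculus
(`MacroClosureLine.StubLedger`, parts 3–5: quadratic velocity polynomial `log prof_s`,
hypotheses (H1)–(H5)), and the quotient rule `(A/Z)' = A'/Z − (A/Z)(Z'/Z) = E[S G] − E[S] E[G]`.

The Gaussian-domination and Gibbs-expectation tools are in part 2a (`…MeanVarianceL2ScoreCore`).
-/

noncomputable section

open MeasureTheory ProbabilityTheory Filter Set Topology
open scoped ENNReal InnerProductSpace

namespace Summit.AtomisticToContinuum.HydrodynamicLimit.Theorems.OneSphereInfluenceMeanVarianceL2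

open Literature.MathematicalPhysics.KineticTheory Literature.Analysis.FluidPDE
open Literature.Analysis.FunctionSpaces
open MacroClosureLine.StubLedger

/-! ## The score identity -/

section ScoreIdentity

variable {σ : ℝ} {N : ℕ}

/-- **The score identity, measure-theoretic assembly.** Given ANY time derivative `ψ'` of the
log-profile within `[0,1]` with (H1)–(H5), for a measurable `s`-independent observable `G` with
`|G| ≤ K(1 + ∑ₖ|vₖ|²)`: `s ↦ E_{p_s} G` has derivative `Cov_{p_s}(∑ₖ ∂ₛ log prof_s(zₖ), G)`
within `[0,1]` at every `s ∈ [0,1]`, and this covariance is continuous on `[0,1]`. [folklore] -/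
theorem hasDerivWithinAt_integral_localGibbsLaw_of_deriv (hσ2 : σ ≤ 1 / 2)
    (Φ : HardSphereFlow (Torus.geometry (Fin 3)) (hsDiameter σ N) (N + 1))
    {a θ : ℝ → T3 → ℝ} {u : ℝ → T3 → V3}
    (hac : ∀ s ∈ Icc (0 : ℝ) 1, Continuous (a s)) (hθc : ∀ s ∈ Icc (0 : ℝ) 1, Continuous (θ s))
    (huc : ∀ s ∈ Icc (0 : ℝ) 1, Continuous (u s)) (ha0 : ∀ s ∈ Icc (0 : ℝ) 1, ∀ x, 0 < a s x)
    (hθ0 : ∀ s ∈ Icc (0 : ℝ) 1, ∀ x, 0 < θ s x) {ψ' : ℝ → T3 × V3 → ℝ} {C₁ C₂ b : ℝ} (hC₁ : 0 ≤ C₁)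
    (hb : 0 < b)
    (H1 : ∀ y, ∀ s ∈ Icc (0 : ℝ) 1, HasDerivWithinAt
      (fun s => Real.log (localGibbsProfile (a s) (u s) (θ s) y)) (ψ' s y) (Icc 0 1) s)
    (H2 : ∀ s ∈ Icc (0 : ℝ) 1, ∀ y, |ψ' s y| ≤ C₁ * (1 + ‖y.2‖ ^ 2))
    (H3 : ∀ s ∈ Icc (0 : ℝ) 1, ∀ y,
      Real.log (localGibbsProfile (a s) (u s) (θ s) y) ≤ C₂ - b * ‖y.2‖ ^ 2)
    (H4 : ∀ s ∈ Icc (0 : ℝ) 1, Measurable (ψ' s))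
    (H5 : ∀ y, ContinuousOn (fun s => ψ' s y) (Icc 0 1))
    {G : Config (N + 1) (Fin 3) T3 → ℝ} (hGm : Measurable G) {K : ℝ} (hK : 0 ≤ K)
    (hG : ∀ z, |G z| ≤ K * (1 + ∑ k, ‖(z k).2‖ ^ 2)) :
    (∀ s ∈ Icc (0 : ℝ) 1, HasDerivWithinAt
        (fun s => ∫ z, G z ∂(localGibbsLaw σ (a s) (u s) (θ s) N Φ))
        (covariance (fun z => ∑ k, derivWithin
            (fun s' => Real.log (localGibbsProfile (a s') (u s') (θ s') (z k))) (Icc 0 1) s) G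
          (localGibbsLaw σ (a s) (u s) (θ s) N Φ)) (Icc 0 1) s) ∧
    ContinuousOn (fun s => covariance (fun z => ∑ k, derivWithin
        (fun s' => Real.log (localGibbsProfile (a s') (u s') (θ s') (z k))) (Icc 0 1) s) G
          (localGibbsLaw σ (a s) (u s) (θ s) N Φ)) (Icc 0 1) := by
  have hU : UniqueDiffOn ℝ (Icc (0 : ℝ) 1) := uniqueDiffOn_Icc zero_lt_one
  have H0 : ∀ s ∈ Icc (0 : ℝ) 1,
      Measurable fun y => Real.log (localGibbsProfile (a s) (u s) (θ s) y) := fun s hs =>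
    Real.measurable_log.comp (measurable_localGibbsProfile (hac s hs) (hθc s hs) (huc s hs))
  set D : Set (Config (N + 1) (Fin 3) T3) :=
    hardSphereDomain (Torus.geometry (Fin 3)) (N + 1) (hsDiameter σ N) with hD_def
  have hD : MeasurableSet D := by
    rw [hD_def]; exact measurableSet_hardSphereDomain _ Torus.measurable_geometry_sepVec _ _
  -- the four integrals `Z, Z', A, A'` (opaque local functions with defining equations)
  set Z : ℝ → ℝ := fun s => canonicalPartition (Torus.geometry (Fin 3)) (hsDiameter σ N) (N + 1)
    (localGibbsProfile (a s) (u s) (θ s)) with hZ_def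
  set Z' : ℝ → ℝ := fun s => ∫ z, D.indicator (fun z =>
    Real.exp (∑ k, Real.log (localGibbsProfile (a s) (u s) (θ s) (z k))) * ∑ k, ψ' s (z k)) z
    with hZ'_def
  set A : ℝ → ℝ := fun s => ∫ z, D.indicator (fun z =>
    Real.exp (∑ k, Real.log (localGibbsProfile (a s) (u s) (θ s) (z k))) * G z) z with hA_def
  set A' : ℝ → ℝ := fun s => ∫ z, D.indicator (fun z =>
    Real.exp (∑ k, Real.log (localGibbsProfile (a s) (u s) (θ s) (z k))) *
      ((∑ k, ψ' s (z k)) * G z)) z with hA'_def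
  clear_value Z Z' A A' D
  have hZ : ∀ s ∈ Icc (0 : ℝ) 1, Z s = ∫ z, D.indicator (fun z =>
      Real.exp (∑ k, Real.log (localGibbsProfile (a s) (u s) (θ s) (z k)))) z := by
    intro s hs
    rw [hZ_def, hD_def, exp_sum_log_localGibbsProfile (ha0 s hs) (hθ0 s hs)]
    rfl
  have hZpos : ∀ s ∈ Icc (0 : ℝ) 1, 0 < Z s := fun s hs => by
    rw [hZ_def]
    exact canonicalPartition_localGibbs_pos hσ2 N (hac s hs) (hθc s hs) (huc s hs) (ha0 s hs)
      (hθ0 s hs)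
  -- derivatives of `Z` and `A` within `[0,1]`
  -- (the one-particle log-density `ψ` is given explicitly: first-order unification only)
  have hZd : ∀ s ∈ Icc (0 : ℝ) 1, HasDerivWithinAt Z (Z' s) (Icc 0 1) s := fun s hs => by
    have h := hasDerivWithinAt_integral_indicator_exp_sum hD (convex_Icc 0 1)
      (ψ := fun s y => Real.log (localGibbsProfile (a s) (u s) (θ s) y)) hC₁ hb H1 H2 H3 H0 H4 hs
    rw [hZ'_def]
    exact h.congr_of_mem (fun s' hs' => hZ s' hs') hs
  have hAd : ∀ s ∈ Icc (0 : ℝ) 1, HasDerivWithinAt A (A' s) (Icc 0 1) s := fun s hs => by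
    have h := hasDerivWithinAt_integral_indicator_exp_sum_mul_obs hD (convex_Icc 0 1)
      (ψ := fun s y => Real.log (localGibbsProfile (a s) (u s) (θ s) y)) hC₁ hb hK H1 H2 H3 H0 H4
      hGm hG hs
    rw [hA_def, hA'_def]
    exact h
  have hZ'c : ContinuousOn Z' (Icc 0 1) := by
    have h := continuousOn_integral_indicator_exp_sum_mul hD
      (ψ := fun s y => Real.log (localGibbsProfile (a s) (u s) (θ s) y)) hC₁ hb H1 H2 H3 H0 H4 H5
    rw [hZ'_def]
    exact h
  have hA'c : ContinuousOn A' (Icc 0 1) := by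
    have h := continuousOn_integral_indicator_exp_sum_mul_obs hD
      (ψ := fun s y => Real.log (localGibbsProfile (a s) (u s) (θ s) y)) hC₁ hb hK H1 H2 H3 H0 H4
      H5 hGm hG
    rw [hA'_def]
    exact h
  have hZc : ContinuousOn Z (Icc 0 1) := fun s hs => (hZd s hs).continuousWithinAt
  have hAc : ContinuousOn A (Icc 0 1) := fun s hs => (hAd s hs).continuousWithinAt
  -- the score
  have hscore : ∀ s ∈ Icc (0 : ℝ) 1, ∀ z : Config (N + 1) (Fin 3) T3,
      (∑ k, derivWithin (fun s' => Real.log (localGibbsProfile (a s') (u s') (θ s') (z k)))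
        (Icc 0 1) s) = ∑ k, ψ' s (z k) := fun s hs z =>
    Finset.sum_congr rfl fun k _ => (H1 (z k) s hs).derivWithin (hU s hs)
  -- Gibbs expectations in terms of `Z, Z', A, A'`
  have hEG : ∀ s ∈ Icc (0 : ℝ) 1,
      ∫ z, G z ∂(localGibbsLaw σ (a s) (u s) (θ s) N Φ) = (Z s)⁻¹ * A s := fun s hs => by
    rw [hZ_def, hA_def, hD_def]
    exact integral_localGibbsLaw_eq Φ (hac s hs) (hθc s hs) (huc s hs) (ha0 s hs) (hθ0 s hs) G
  have hES : ∀ s ∈ Icc (0 : ℝ) 1,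
      ∫ z, (∑ k, ψ' s (z k)) ∂(localGibbsLaw σ (a s) (u s) (θ s) N Φ) = (Z s)⁻¹ * Z' s :=
    fun s hs => by
    rw [hZ_def, hZ'_def, hD_def]
    exact integral_localGibbsLaw_eq Φ (hac s hs) (hθc s hs) (huc s hs) (ha0 s hs) (hθ0 s hs) _
  have hESG : ∀ s ∈ Icc (0 : ℝ) 1,
      ∫ z, (∑ k, ψ' s (z k)) * G z ∂(localGibbsLaw σ (a s) (u s) (θ s) N Φ) = (Z s)⁻¹ * A' s :=
    fun s hs => by
    rw [hZ_def, hA'_def, hD_def]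
    exact integral_localGibbsLaw_eq Φ (hac s hs) (hθc s hs) (huc s hs) (ha0 s hs) (hθ0 s hs) _
  -- integrability of the score, the observable and their product
  have hprob : ∀ s ∈ Icc (0 : ℝ) 1, IsProbabilityMeasure (localGibbsLaw σ (a s) (u s) (θ s) N Φ) :=
    fun s hs => isProbabilityMeasure_localGibbsLaw (hac s hs) (hθc s hs) (huc s hs) (ha0 s hs)
      (hθ0 s hs) hσ2 N Φ
  have hSm : ∀ s ∈ Icc (0 : ℝ) 1, Measurable fun z : Config (N + 1) (Fin 3) T3 => ∑ k, ψ' s (z k) :=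
    fun s hs => Finset.measurable_sum _ fun k _ => (H4 s hs).comp (measurable_pi_apply k)
  have hSbd : ∀ s ∈ Icc (0 : ℝ) 1, ∀ z : Config (N + 1) (Fin 3) T3,
      |∑ k, ψ' s (z k)| ≤ (C₁ * ((N : ℝ) + 1)) * (1 + ∑ k, ‖(z k).2‖ ^ 2) :=
    fun s hs z => abs_sum_le_of_quad hC₁ (H2 s hs) z
  have hSGbd : ∀ s ∈ Icc (0 : ℝ) 1, ∀ z : Config (N + 1) (Fin 3) T3,
      |(∑ k, ψ' s (z k)) * G z| ≤ (C₁ * ((N : ℝ) + 1) * K) * (1 + ∑ k, ‖(z k).2‖ ^ 2) ^ 2 := by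
    intro s hs z
    rw [abs_mul]
    calc |∑ k, ψ' s (z k)| * |G z|
        ≤ (C₁ * ((N : ℝ) + 1) * (1 + ∑ k, ‖(z k).2‖ ^ 2)) * (K * (1 + ∑ k, ‖(z k).2‖ ^ 2)) :=
          mul_le_mul (hSbd s hs z) (hG z) (abs_nonneg _) (by have := sum_sq_norm_nonneg z; positivity)
      _ = _ := by ring
  have hGi : ∀ s ∈ Icc (0 : ℝ) 1, Integrable G (localGibbsLaw σ (a s) (u s) (θ s) N Φ) :=
    fun s hs => integrable_localGibbsLaw_of_le Φ (hac s hs) (hθc s hs) (huc s hs) (ha0 s hs)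
      (hθ0 s hs) hK hb (H3 s hs) hGm hG
  have hSi : ∀ s ∈ Icc (0 : ℝ) 1,
      Integrable (fun z => ∑ k, ψ' s (z k)) (localGibbsLaw σ (a s) (u s) (θ s) N Φ) :=
    fun s hs => integrable_localGibbsLaw_of_le Φ (hac s hs) (hθc s hs) (huc s hs) (ha0 s hs)
      (hθ0 s hs) (by positivity) hb (H3 s hs) (hSm s hs) (hSbd s hs)
  have hSGi : ∀ s ∈ Icc (0 : ℝ) 1,
      Integrable (fun z => (∑ k, ψ' s (z k)) * G z) (localGibbsLaw σ (a s) (u s) (θ s) N Φ) :=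
    fun s hs => integrable_localGibbsLaw_of_sq Φ (hac s hs) (hθc s hs) (huc s hs) (ha0 s hs)
      (hθ0 s hs) (by positivity) hb (H3 s hs) ((hSm s hs).mul hGm) (hSGbd s hs)
  -- the covariance in terms of `Z, Z', A, A'`
  have hcov : ∀ s ∈ Icc (0 : ℝ) 1, covariance (fun z => ∑ k, derivWithin
      (fun s' => Real.log (localGibbsProfile (a s') (u s') (θ s') (z k))) (Icc 0 1) s) G
        (localGibbsLaw σ (a s) (u s) (θ s) N Φ) =
      (Z s)⁻¹ * A' s - (Z s)⁻¹ * Z' s * ((Z s)⁻¹ * A s) := by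
    intro s hs
    haveI := hprob s hs
    have hfun : (fun z : Config (N + 1) (Fin 3) T3 => ∑ k, derivWithin
        (fun s' => Real.log (localGibbsProfile (a s') (u s') (θ s') (z k))) (Icc 0 1) s) =
        fun z => ∑ k, ψ' s (z k) := funext (hscore s hs)
    rw [hfun, covariance_eq_integral_mul_sub (hSi s hs) (hGi s hs) (hSGi s hs), hESG s hs, hES s hs,
      hEG s hs]
  refine ⟨fun s hs => ?_, ?_⟩
  · -- quotient rule
    have hq : HasDerivWithinAt (fun s => (Z s)⁻¹ * A s)
        (-(Z' s) / (Z s) ^ 2 * A s + (Z s)⁻¹ * A' s) (Icc 0 1) s :=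
      ((hZd s hs).inv (hZpos s hs).ne').mul (hAd s hs)
    refine (hq.congr_of_mem (fun s' hs' => hEG s' hs') hs).congr_deriv ?_
    rw [hcov s hs]
    ring
  · have hg : ContinuousOn (fun s => (Z s)⁻¹ * A' s - (Z s)⁻¹ * Z' s * ((Z s)⁻¹ * A s)) (Icc 0 1) := by
      have hZi : ContinuousOn (fun s => (Z s)⁻¹) (Icc 0 1) := hZc.inv₀ fun s hs => (hZpos s hs).ne'
      exact (hZi.mul hA'c).sub ((hZi.mul hZ'c).mul (hZi.mul hAc))
    exact hg.congr fun s hs => hcov s hs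

/-- **The score identity for smooth local Gibbs families.** For `σ ≤ 1/2`, a smooth positive
one-parameter family of local Gibbs profiles `(a_s, u_s, θ_s)` on `[0,1] × 𝕋³` and a measurable
`s`-independent observable `G` with `|G(z)| ≤ K (1 + ∑ₖ|vₖ|²)`:
`s ↦ E_{p_s} G` has derivative `Cov_{p_s}(S_s, G)` within `[0,1]` at every `s ∈ [0,1]`, where
`S_s(z) = ∑ₖ ∂ₛ log prof_s(zₖ)` is the score (`∂ₛ = derivWithin · (Icc 0 1)`), and
`s ↦ Cov_{p_s}(S_s, G)` is continuous on `[0,1]`. [folklore] -/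
theorem hasDerivWithinAt_integral_localGibbsLaw (hσ2 : σ ≤ 1 / 2)
    (Φ : HardSphereFlow (Torus.geometry (Fin 3)) (hsDiameter σ N) (N + 1))
    {a θ : ℝ → T3 → ℝ} {u : ℝ → T3 → V3}
    (ha : Torus.IsSmoothSpaceTimeOn (Icc 0 1) a) (hθ : Torus.IsSmoothSpaceTimeOn (Icc 0 1) θ)
    (hu : Torus.IsSmoothSpaceTimeOn (Icc 0 1) u) (ha0 : ∀ s ∈ Icc (0 : ℝ) 1, ∀ x, 0 < a s x)
    (hθ0 : ∀ s ∈ Icc (0 : ℝ) 1, ∀ x, 0 < θ s x)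
    {G : Config (N + 1) (Fin 3) T3 → ℝ} (hGm : Measurable G) {K : ℝ} (hK : 0 ≤ K)
    (hG : ∀ z, |G z| ≤ K * (1 + ∑ k, ‖(z k).2‖ ^ 2)) :
    (∀ s ∈ Icc (0 : ℝ) 1, HasDerivWithinAt
        (fun s => ∫ z, G z ∂(localGibbsLaw σ (a s) (u s) (θ s) N Φ))
        (covariance (fun z => ∑ k, derivWithin
            (fun s' => Real.log (localGibbsProfile (a s') (u s') (θ s') (z k))) (Icc 0 1) s) G
          (localGibbsLaw σ (a s) (u s) (θ s) N Φ)) (Icc 0 1) s) ∧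
    ContinuousOn (fun s => covariance (fun z => ∑ k, derivWithin
        (fun s' => Real.log (localGibbsProfile (a s') (u s') (θ s') (z k))) (Icc 0 1) s) G
          (localGibbsLaw σ (a s) (u s) (θ s) N Φ)) (Icc 0 1) := by
  have hSc : IsCompact (Icc (0 : ℝ) 1) := isCompact_Icc
  have hU : UniqueDiffOn ℝ (Icc (0 : ℝ) 1) := uniqueDiffOn_Icc zero_lt_one
  have hα := isSmoothSpaceTimeOn_gibbsAlpha ha hθ hu ha0 hθ0
  have hβ := isSmoothSpaceTimeOn_gibbsBeta hθ hθ0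
  have hγ := isSmoothSpaceTimeOn_gibbsGamma hθ hu hθ0
  obtain ⟨C₁, hC₁, H2⟩ := exists_abs_quad_deriv_le hSc hU hα hβ hγ
  obtain ⟨b₀, hb₀, hβle⟩ := exists_gibbsBeta_le hSc hθ hθ0
  obtain ⟨C₂, H3⟩ := exists_quad_le hSc hα hγ hb₀ hβle
  refine hasDerivWithinAt_integral_localGibbsLaw_of_deriv (C₂ := C₂) hσ2 Φ
    (fun s hs => (ha.isSmooth_slice hs).continuous) (fun s hs => (hθ.isSmooth_slice hs).continuous)
    (fun s hs => (hu.isSmooth_slice hs).continuous) ha0 hθ0 hC₁ (half_pos hb₀) (fun y s hs => ?_)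
    (fun s hs y => H2 s hs y.1 y.2) (fun s hs y => ?_)
    (fun s hs => (continuous_quad_deriv hU hα hβ hγ hs).measurable)
    (fun y => continuousOn_quad_deriv hU hα hβ hγ y) hGm hK hG
  · exact (hasDerivWithinAt_quad hα hβ hγ y.1 y.2 hs).congr_of_mem
      (fun s' hs' => log_localGibbsProfile_eq_quad ha0 hθ0 hs' y.1 y.2) hs
  · rw [log_localGibbsProfile_eq_quad ha0 hθ0 hs y.1 y.2]
    exact H3 s hs y.1 y.2

/-- **Gaussian domination of the log-profile along a smooth family**: there are `C₂` and `b > 0`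
with `log prof_s(x,v) ≤ C₂ − b|v|²` for all `s ∈ [0,1]` (exported for the `L²` bounds of the later
parts). [folklore] -/
theorem exists_log_localGibbsProfile_le {a θ : ℝ → T3 → ℝ} {u : ℝ → T3 → V3}
    (ha : Torus.IsSmoothSpaceTimeOn (Icc 0 1) a) (hθ : Torus.IsSmoothSpaceTimeOn (Icc 0 1) θ)
    (hu : Torus.IsSmoothSpaceTimeOn (Icc 0 1) u) (ha0 : ∀ s ∈ Icc (0 : ℝ) 1, ∀ x, 0 < a s x)
    (hθ0 : ∀ s ∈ Icc (0 : ℝ) 1, ∀ x, 0 < θ s x) :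
    ∃ C₂ b : ℝ, 0 < b ∧ ∀ s ∈ Icc (0 : ℝ) 1, ∀ y : T3 × V3,
      Real.log (localGibbsProfile (a s) (u s) (θ s) y) ≤ C₂ - b * ‖y.2‖ ^ 2 := by
  have hSc : IsCompact (Icc (0 : ℝ) 1) := isCompact_Icc
  have hα := isSmoothSpaceTimeOn_gibbsAlpha ha hθ hu ha0 hθ0
  have hγ := isSmoothSpaceTimeOn_gibbsGamma hθ hu hθ0
  obtain ⟨b₀, hb₀, hβle⟩ := exists_gibbsBeta_le hSc hθ hθ0
  obtain ⟨C₂, H3⟩ := exists_quad_le hSc hα hγ hb₀ hβle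
  refine ⟨C₂, b₀ / 2, half_pos hb₀, fun s hs y => ?_⟩
  rw [log_localGibbsProfile_eq_quad ha0 hθ0 hs y.1 y.2]
  exact H3 s hs y.1 y.2

end ScoreIdentity

section Interior

variable {σ : ℝ} {N : ℕ}

/-- **The score identity at interior points**: for `s ∈ (0,1)` the one-sided statement of
`hasDerivWithinAt_integral_localGibbsLaw` is a genuine (two-sided) derivative,
`d/ds E_{p_s} G = Cov_{p_s}(S_s, G)`. [folklore] -/
theorem hasDerivAt_integral_localGibbsLaw (hσ2 : σ ≤ 1 / 2)
    (Φ : HardSphereFlow (Torus.geometry (Fin 3)) (hsDiameter σ N) (N + 1))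
    {a θ : ℝ → T3 → ℝ} {u : ℝ → T3 → V3}
    (ha : Torus.IsSmoothSpaceTimeOn (Icc 0 1) a) (hθ : Torus.IsSmoothSpaceTimeOn (Icc 0 1) θ)
    (hu : Torus.IsSmoothSpaceTimeOn (Icc 0 1) u) (ha0 : ∀ s ∈ Icc (0 : ℝ) 1, ∀ x, 0 < a s x)
    (hθ0 : ∀ s ∈ Icc (0 : ℝ) 1, ∀ x, 0 < θ s x)
    {G : Config (N + 1) (Fin 3) T3 → ℝ} (hGm : Measurable G) {K : ℝ} (hK : 0 ≤ K)
    (hG : ∀ z, |G z| ≤ K * (1 + ∑ k, ‖(z k).2‖ ^ 2)) {s : ℝ} (hs : s ∈ Ioo (0 : ℝ) 1) :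
    HasDerivAt (fun s => ∫ z, G z ∂(localGibbsLaw σ (a s) (u s) (θ s) N Φ))
      (covariance (fun z => ∑ k, derivWithin
          (fun s' => Real.log (localGibbsProfile (a s') (u s') (θ s') (z k))) (Icc 0 1) s) G
        (localGibbsLaw σ (a s) (u s) (θ s) N Φ)) s :=
  ((hasDerivWithinAt_integral_localGibbsLaw hσ2 Φ ha hθ hu ha0 hθ0 hGm hK hG).1 s
    (Ioo_subset_Icc_self hs)).hasDerivAt (Icc_mem_nhds hs.1 hs.2)

end Interior

end Summit.AtomisticToContinuum.HydrodynamicLimit.Theorems.OneSphereInfluenceMeanVarianceL2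

end
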